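import Mathlib
import Summits.Schanuel.Schanuel.Theses.RigidCore
import Summits.Schanuel.Schanuel.Theorems.AclSubsetLogFreeCore.Negative.LogFreeCoreObjects
import Summits.Schanuel.Schanuel.Theorems.MinimalCounterexampleInAcl.Negative.TrdegLoadBearing
import Literature.NumberTheory.Transcendental.OneMotiveToricProofs
import Literature.NumberTheory.Transcendental.LindemannWeierstrassProofs
import Literature.NumberTheory.Transcendental.GammaFields
import Literature.NumberTheory.Transcendental.ZilberFieldExistenceProofs

/-!
# Crux `MinimalCounterexampleInAcl` (stmt-Schanuel-0969) — locus mates: targets of the line `span-growth-dichotomy`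

Negative knowledge / support for the registered skeleton
`Cruxes/MinimalCounterexampleInAcl/Lines/span-growth-dichotomy.lean` (stubs `stub_matePredim` T1,
`stub_spanGrowthStep` T2, `stub_locusDefectBounded` D, `stub_finiteRankCase` M, `stub_isolationFree` I),
landed by the crux disprover (`--supports`).  All PROVED:

* `locusMates` — verbatim the skeleton's vocabulary (ℚ-linearly independent tuples satisfying every
  ℚ-polynomial relation of `(x, eˣ)`), so that `SpanGrowthDichotomy.locusMates = locusMates` by `rfl`;
* `locusMates_twoPiTuple`, `locusMates_twoPiTuple_infinite`, `locusMates_twoPiTuple_subset_span` — the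
  mates of the defect-ZERO tuple `(2πi)` are exactly `(2πik)`, `k ≠ 0`: infinitely many, all in
  `span{2πi}`;
* `finiteRankCase_false_without_firstFailure` — hence **Stub M is FALSE for general ℚ-linearly
  independent tuples**: the hypothesis `trdeg < n` of `IsFirstFailure` (isolation of the graph points
  on `W_x ∩ Γ`, `dim W_x < n`) is load-bearing for M (and for `BranchFiniteness` of the sibling line);
* BRIDGE to the predimension: `td_bot_span_range`, `predim_bot_span_range` (`δ(⟨x⟩_ℚ/0) = rk(x ∪ eˣ) − n`
  for LI `x`), `predim_le_neg_one_iff` (**for LI `x'`, `δ(⟨x'⟩/0) ≤ −1 ↔ trdeg ℚ(x', e^{x'}) < n`**: the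
  standing hypothesis of T1/T2 says "`x'` is a rank-`n` Schanuel counterexample", so every stub is
  vacuous under Schanuel — `not_schanuelRank_of_predim_le_neg_one`), and TIGHTNESS
  `neg_one_le_predim_of_ranks_below` / `firstFailure_predim_eq`: at a first-failure rank no LI `n`-tuple
  has `δ < −1`, each mate has `δ = −1` exactly (T1 is sharp) — these two live in the crux work file
  `Cruxes/MinimalCounterexampleInAcl/Disproof.lean` (`neg_one_le_predim_of_ranks_below`,
  `IsFirstFailure.predim_eq`) pending the build of `FirstFailureEcl`;
* (definable isolation — Stub I — is proved in the sibling file `IsolationFree.lean`.)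

## References

* [KirbyMacintyreOnshuus2012] J. Kirby, A. Macintyre, A. Onshuus, *The algebraic numbers definable in
  various exponential fields*, J. Inst. Math. Jussieu 11 (2012), arXiv:1101.4224, §2.2 (`ℤ` is `∅`-definable).
* M. Bays, J. Kirby, *Pseudo-exponential maps, variants, and quasiminimality*, Algebra & Number Theory
  12 (2018), arXiv:1512.04262, Def. 4.1, Lemma 4.2 (predimension).
* J. Kirby, *Exponential algebraicity in exponential fields*, Bull. LMS 42 (2010), arXiv:0810.4285.
-/

noncomputable section

set_option linter.dupNamespace false

open Complex Set
open FirstOrder FirstOrder.Language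
open Literature.NumberTheory.Transcendental
open Literature.ModelTheory.ExponentialFields
open Summit.Schanuel.Schanuel.Theorems.AclSubsetLogFreeCore.Negative

namespace Summit.Schanuel.Schanuel.Theorems.MinimalCounterexampleInAcl.Negative

/-! ### Vocabulary -/

/-- The ℚ-locus mates of `x`: tuples `x'` that are ℚ-linearly independent and satisfy every
ℚ-polynomial relation of `(x, eˣ)` (verbatim the skeleton's `SpanGrowthDichotomy.locusMates`). [folklore] -/
def locusMates {n : ℕ} (x : Fin n → ℂ) : Set (Fin n → ℂ) :=
  {x' | LinearIndependent ℚ x' ∧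
    ∀ p : MvPolynomial (Fin n ⊕ Fin n) ℚ,
      MvPolynomial.aeval (Sum.elim x (cexp ∘ x)) p = 0 →
      MvPolynomial.aeval (Sum.elim x' (cexp ∘ x')) p = 0}

/-- `x` is a locus mate of itself as soon as it is ℚ-linearly independent. [folklore] -/
theorem self_mem_locusMates {n : ℕ} {x : Fin n → ℂ} (hx : LinearIndependent ℚ x) :
    x ∈ locusMates x :=
  ⟨hx, fun _ hp => hp⟩

/-! ### The witness `(2πi)`: Stub M needs the first-failure hypothesis -/

/-- The WITNESS tuple: `n = 1`, `x = (2πi)` — ℚ-linearly independent with `trdeg ℚ(2πi, 1) = 1 = n`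
(defect ZERO, not a first failure). [folklore] -/
def twoPiTuple : Fin 1 → ℂ := fun _ => 2 * Real.pi * I

/-- Substituting `Y ↦ 1` turns a polynomial in `(X, Y)` into a one-variable polynomial. [folklore] -/
def substY1 : MvPolynomial (Fin 1 ⊕ Fin 1) ℚ →ₐ[ℚ] Polynomial ℚ :=
  MvPolynomial.aeval (Sum.elim (fun _ => Polynomial.X) (fun _ => 1))

/-- On a tuple `(c)` with `e^c = 1`, evaluation factors through `substY1`. [folklore] -/
theorem aeval_eq_of_exp_eq_one {c : ℂ} (hc : cexp c = 1) (p : MvPolynomial (Fin 1 ⊕ Fin 1) ℚ) :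
    MvPolynomial.aeval (Sum.elim (fun _ : Fin 1 => c) (cexp ∘ fun _ : Fin 1 => c)) p =
      Polynomial.aeval c (substY1 p) := by
  have key : (MvPolynomial.aeval (Sum.elim (fun _ : Fin 1 => c) (cexp ∘ fun _ : Fin 1 => c)) :
      MvPolynomial (Fin 1 ⊕ Fin 1) ℚ →ₐ[ℚ] ℂ) = (Polynomial.aeval c).comp substY1 := by
    refine MvPolynomial.algHom_ext fun i => ?_
    rcases i with i | i
    · simp [substY1]
    · simp [substY1, hc]
  exact congrArg (fun f : MvPolynomial (Fin 1 ⊕ Fin 1) ℚ →ₐ[ℚ] ℂ => f p) key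

/-- `e^{2πik} = 1`. [folklore] -/
theorem cexp_two_pi_I_mul_int (k : ℤ) : cexp (2 * Real.pi * I * k) = 1 := by
  rw [show (2 * ↑Real.pi * I * ↑k : ℂ) = k * (2 * Real.pi * I) by ring]
  exact Complex.exp_int_mul_two_pi_mul_I k

/-- **The locus mates of `(2πi)` are exactly the nonzero kernel elements `(2πik)`, `k ≠ 0`**: the
ℚ-locus of `(2πi, 1)` is `{Y = 1}` (`2πi` is transcendental) and `{Y = 1} ∩ Γ_exp = 2πiℤ`. [folklore] -/
theorem locusMates_twoPiTuple :
    locusMates twoPiTuple = {x' | ∃ k : ℤ, k ≠ 0 ∧ x' = fun _ => 2 * Real.pi * I * k} := by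
  ext x'
  constructor
  · rintro ⟨hli, hrel⟩
    have h1 : cexp (x' 0) = 1 := by
      have h := hrel (MvPolynomial.X (Sum.inr 0) - 1) (by simp [twoPiTuple])
      simpa [sub_eq_zero] using h
    obtain ⟨k, hk⟩ := Complex.exp_eq_one_iff.1 h1
    refine ⟨k, ?_, ?_⟩
    · rintro rfl
      simp only [Int.cast_zero, zero_mul] at hk
      exact hli.ne_zero 0 hk
    · funext i
      rw [Subsingleton.elim i 0, hk]
      ring
  · rintro ⟨k, hk, rfl⟩
    refine ⟨linearIndependent_const_fin_one ?_, fun p hp => ?_⟩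
    · exact mul_ne_zero two_pi_I_ne_zero (Int.cast_ne_zero.2 hk)
    · have htwo : cexp (2 * Real.pi * I : ℂ) = 1 := by simp
      have h0 : Polynomial.aeval (2 * Real.pi * I : ℂ) (substY1 p) = 0 := by
        rw [← aeval_eq_of_exp_eq_one htwo]; exact hp
      have hp0 : substY1 p = 0 := by
        by_contra hne
        exact transcendental_two_pi_I ⟨substY1 p, hne, h0⟩
      rw [aeval_eq_of_exp_eq_one (cexp_two_pi_I_mul_int k), hp0, map_zero]

/-- All mates of `(2πi)` lie in the ONE-dimensional space `span{2πi}` … [folklore] -/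
theorem locusMates_twoPiTuple_subset_span :
    ∀ x' ∈ locusMates twoPiTuple,
      range x' ⊆ (Submodule.span ℚ (({2 * Real.pi * I} : Finset ℂ) : Set ℂ) : Set ℂ) := by
  intro x' hx'
  rw [locusMates_twoPiTuple] at hx'
  obtain ⟨k, -, rfl⟩ := hx'
  rintro a ⟨i, rfl⟩
  rw [Finset.coe_singleton]
  have hk : (2 * ↑Real.pi * I * ↑k : ℂ) = (k : ℚ) • (2 * Real.pi * I : ℂ) := by
    rw [Rat.smul_def, Rat.cast_intCast]; ring
  rw [hk]
  exact Submodule.smul_mem _ _ (Submodule.subset_span rfl)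

/-- … yet there are INFINITELY many of them. [folklore] -/
theorem locusMates_twoPiTuple_infinite : (locusMates twoPiTuple).Infinite := by
  rw [locusMates_twoPiTuple]
  have hinj : Function.Injective (fun k : ℤ => (fun _ : Fin 1 => (2 * Real.pi * I * k : ℂ))) := by
    intro a b hab
    have h := congrFun hab 0
    simp only [mul_eq_mul_left_iff, Int.cast_inj, two_pi_I_ne_zero, or_false] at h
    exact h
  have hinf : (Set.range fun k : {k : ℤ // k ≠ 0} =>
      (fun _ : Fin 1 => (2 * Real.pi * I * (k : ℤ) : ℂ))).Infinite := by
    haveI : Infinite {k : ℤ // k ≠ 0} := Infinite.of_injective (fun n : ℕ => ⟨(n : ℤ) + 1, by omega⟩)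
      (fun a b h => by simpa using congrArg Subtype.val h)
    exact Set.infinite_range_of_injective fun a b hab => Subtype.ext (hinj hab)
  refine hinf.mono ?_
  rintro x' ⟨⟨k, hk⟩, rfl⟩
  exact ⟨k, hk, rfl⟩

/-- **Stub M (`stub_finiteRankCase`) is FALSE without the first-failure hypothesis**: "mates confined
to a finite-dimensional ℚ-space are finitely many" fails for the ℚ-linearly independent, defect-ZERO
tuple `(2πi)` — all its mates `(2πik)` sit in `span{2πi}` and there are infinitely many. So any proof of
M must use `trdeg < n` (isolation: for a first failure `dim W_x < n`; here `dim W = 1 = n` and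
`W ∩ Γ = 2πiℤ` is discrete but infinite). The same witness (`k ↦ 2πi + 2πik`) kills
`BranchFiniteness` without first failure. [folklore] -/
theorem finiteRankCase_false_without_firstFailure :
    ¬ ∀ (n : ℕ) (x : Fin n → ℂ), LinearIndependent ℚ x → ∀ s : Finset ℂ,
        (∀ x' ∈ locusMates x, range x' ⊆ (Submodule.span ℚ (s : Set ℂ) : Set ℂ)) →
          (locusMates x).Finite := by
  intro h
  refine locusMates_twoPiTuple_infinite (h 1 twoPiTuple ?_ {2 * Real.pi * I}
    locusMates_twoPiTuple_subset_span)
  exact linearIndependent_const_fin_one two_pi_I_ne_zero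

/-! ### Bridge: the skeleton's `GammaField.predim ⊥ (span x')` versus `trdeg ℚ(x', e^{x'})` -/

section Bridge
open GammaField

/-- `td(⟨x⟩_ℚ / 0)` is the rank of `x ∪ eˣ` in the algebraic matroid of `ℂ/ℚ`.
[cite: BaysKirby2018ANT, Def. 4.1] -/
theorem td_bot_span_range {n : ℕ} (x : Fin n → ℂ) :
    td (⊥ : Submodule ℚ ℂ) (Submodule.span ℚ (range x)) =
      (algMatroid ℂ).eRk (range x ∪ range (cexp ∘ x)) := by
  refine le_antisymm ?_ ?_
  · have hsub : gens (Submodule.span ℚ (range x)) ⊆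
        (algMatroid ℂ).closure (range x ∪ range (cexp ∘ x)) := by
      have h1 := gens_sup_span_subset_acl (⊥ : Submodule ℚ ℂ) (range x)
      rw [bot_sup_eq] at h1
      refine h1.trans (acl_subset_acl_of_subset ?_)
      rintro a (ha | ha | ha)
      · have ha' : a ∈ (algMatroid ℂ).closure (gens (⊥ : Submodule ℚ ℂ)) := subset_acl _ ha
        rw [ZilberHomogeneity.closure_gens_bot] at ha'
        exact (algMatroid ℂ).closure_subset_closure (empty_subset _) ha'
      · exact subset_acl _ (Or.inl ha)
      · exact subset_acl _ (Or.inr (by rwa [range_comp]))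
    rw [ZilberHomogeneity.td_bot, ← (algMatroid ℂ).eRk_closure_eq (range x ∪ range (cexp ∘ x))]
    exact (algMatroid ℂ).eRk_mono hsub
  · rw [ZilberHomogeneity.td_bot]
    refine (algMatroid ℂ).eRk_mono ?_
    rintro a (⟨i, rfl⟩ | ⟨i, rfl⟩)
    · exact mem_gens_of_mem (Submodule.subset_span ⟨i, rfl⟩)
    · exact exp_mem_gens (Submodule.subset_span ⟨i, rfl⟩)

/-- The rank of the finite set `x ∪ eˣ` is finite. [folklore] -/
theorem eRk_range_ne_top {n : ℕ} (x : Fin n → ℂ) :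
    (algMatroid ℂ).eRk (range x ∪ range (cexp ∘ x)) ≠ ⊤ := by
  refine ne_top_of_le_ne_top ?_ ((algMatroid ℂ).eRk_le_encard _)
  exact ((finite_range x).union (finite_range _)).encard_lt_top.ne

/-- **Bridge**: for ℚ-linearly independent `x`, `δ(⟨x⟩_ℚ/0) = rk(x ∪ eˣ) − n`.
[cite: BaysKirby2018ANT, Def. 4.1] -/
theorem predim_bot_span_range {n : ℕ} {x : Fin n → ℂ} (hx : LinearIndependent ℚ x) :
    predim (⊥ : Submodule ℚ ℂ) (Submodule.span ℚ (range x)) =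
      (((algMatroid ℂ).eRk (range x ∪ range (cexp ∘ x))).toNat : ℤ) - n := by
  rw [predim_def, td_bot_span_range,
    ldim_span_eq_of_linIndepOver (linIndepOver_bot_of_linearIndependent hx)]

/-- `m ≤ trdeg ℚ(x, eˣ)` iff `m ≤ rk(x ∪ eˣ)`. [folklore] -/
theorem natCast_le_trdeg_iff {n : ℕ} (x : Fin n → ℂ) (m : ℕ) :
    (m : Cardinal) ≤ Algebra.trdeg ℚ ↥(IntermediateField.adjoin ℚ (range x ∪ range (cexp ∘ x))) ↔
      (m : ℕ∞) ≤ (algMatroid ℂ).eRk (range x ∪ range (cexp ∘ x)) :=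
  ⟨ZilberHomogeneity.natCast_le_eRk_of_le_trdeg, le_trdeg_adjoin_of_natCast_le_eRk⟩

/-- **For LI `x'`, `δ(⟨x'⟩_ℚ/0) ≤ −1 ↔ trdeg ℚ(x', e^{x'}) < n`**: the standing hypothesis of Stubs
T1/T2 says "`x'` is a Schanuel counterexample at rank `n`". [cite: BaysKirby2018ANT, §9.1] -/
theorem predim_le_neg_one_iff {n : ℕ} {x : Fin n → ℂ} (hx : LinearIndependent ℚ x) :
    predim (⊥ : Submodule ℚ ℂ) (Submodule.span ℚ (range x)) ≤ -1 ↔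
      Algebra.trdeg ℚ ↥(IntermediateField.adjoin ℚ (range x ∪ range (cexp ∘ x))) < (n : Cardinal) := by
  rw [predim_bot_span_range hx, ← not_le, natCast_le_trdeg_iff]
  set r := (algMatroid ℂ).eRk (range x ∪ range (cexp ∘ x)) with hr
  have hr' : r = (r.toNat : ℕ∞) := (ENat.coe_toNat (eRk_range_ne_top x)).symm
  constructor
  · intro h hle
    rw [hr'] at hle
    have : n ≤ r.toNat := by exact_mod_cast hle
    omega
  · intro h
    have : ¬ n ≤ r.toNat := fun hle => h (by rw [hr']; exact_mod_cast hle)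
    omega

/-- Hence Stub T2's standing hypotheses (`hli`, `hδ`) contradict `SchanuelRank n`: T2 — like T1, D,
M, I — is VACUOUSLY TRUE under Schanuel and cannot be refuted short of an explicit Schanuel
counterexample. [folklore] -/
theorem not_schanuelRank_of_predim_le_neg_one {n : ℕ} {x : Fin n → ℂ} (hx : LinearIndependent ℚ x)
    (hδ : predim (⊥ : Submodule ℚ ℂ) (Submodule.span ℚ (range x)) ≤ -1) : ¬ SchanuelRank n :=
  fun h => (not_le.2 ((predim_le_neg_one_iff hx).1 hδ)) (h x hx)

end Bridge

end Summit.Schanuel.Schanuel.Theorems.MinimalCounterexampleInAcl.Negative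

end
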